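import Mathlib
import Summits.ValiantsHypothesis.ValiantsHypothesis.Theorems.LacunarySymmetroidMatrixDescartesDefiniteMomentsKit
import Summits.ValiantsHypothesis.ValiantsHypothesis.Theorems.LacunarySymmetroidMatrixDescartesMomentLaw

/-!
# `MatrixDescartes` (stmt-ValiantsHypothesis-18050) — the DEFINITE-MOMENTS LAW, XI: the INDEX form of the window
# engine («a directed window carries at most (positive index at its positive end) zeros») and the negative-moment
# law in RANK form (`Z₊ ≤ 2·rank(P₁ + ⋯ + P_K)`)

HONEST FRAMING.  Cell `pub-symmetroid`, seat `val-sym-mdr-p2` (gen 14); helper file `--supports` the crux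
`Theses.LacunarySymmetroid.MatrixDescartes`, NO closure claim.  Refinements of the directed-window count; nothing here bears
on the crux in its window, on `stub_twoSided`, on `DoorA26`/`DoorA34`, registers, or `VP ≠ VNP`.

CONTENT.  (1) `card_le_index_of_directed` — the tree's directed kernel chain (`MomentLaw.quadForm_sum_pos`: under the
propagation «`0 ≤ xᵀG(s)x ⇒ 0 < xᵀG(t)x` for `rel s t`», non-zero combinations of kernel vectors are POSITIVE at every
later time) read as an INDEX bound: if some time `a` is later than all kernel times and `G(a) ⪯ W Wᵀ` for an `ι × q` matrix
`W` (positive index of `G(a)` at most `q`), then there are at most `q` kernel times — the span of the kernel vectors is a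
`G(a)`-positive subspace meeting `ker Wᵀ` trivially.  This is conjb-1's one-sided index rung `OneSidedIndexRung` (`Z₊ ≤ q`,
tree `oneSidedIndexRung_holds`) transplanted from Loewner-monotone pencils to ARBITRARY directed windows, and it refines
`…DefiniteMoments.card_roots_window_le` (there `q = card ι`).  (2) Pencil forms `card_roots_filter_le_index_down/_up`: a
window on which positivity of the Rayleigh forms propagates towards an anchor scale `a` where `F(a) ⪯ W Wᵀ` carries
`≤ q` zeros.  (3) `negMoment_posRoots_le_rank`: the NEGATIVE-MOMENT LAW IN RANK FORM — `F = X^e J + ∑ X^{dₖ}Pₖ`, `Pₖ ⪰ 0` on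
both sides, `J` symmetric, `F(x₀) ≺ 0` at one scale, and `∑ₖ Pₖ ⪯ W Wᵀ` with `W` of width `q` (e.g. `q =` total rank of the
PSD letters) ⇒ `Z₊ ≤ 2q` (g10's `negMoment_posRoots_le` is `q = card ι`; with `K − 1` rank-one letters this reads
`Z₊ ≤ 2(K−1)`, a Descartes-type count inside a K-free law).  Windows are directed by g10's convexity
(`MomentLaw.propagate_above/below`); at a scale beyond all zeros `H(s) = J + ∑ (s^{dₖ}/s^e)Pₖ ⪯ C·∑Pₖ ⪯ C·WWᵀ` since `J ≺ 0`.
[folklore]; axioms `propext`, `Classical.choice`, `Quot.sound`; no definitions.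
-/

-- layout Summits/ValiantsHypothesis/ValiantsHypothesis forces the duplicated namespace component
set_option linter.dupNamespace false

namespace Summit.ValiantsHypothesis.ValiantsHypothesis.Theorems.LacunarySymmetroidMatrixDescartes

open Polynomial Matrix Finset
open scoped BigOperators

namespace DefiniteMoments

/-! ## §1 The index form of the directed kernel chain -/

section Engine

variable {ι : Type} [Fintype ι] [DecidableEq ι]

/-- **Directed chain, index form.**  `G` symmetric on `S`, propagation «`0 ≤ xᵀG(s)x ⇒ 0 < xᵀG(t)x`» for `rel s t`;
kernel times `τ j ∈ S` forming a `rel`-chain; a time `a ∈ S` later than all of them with `G(a) ⪯ W Wᵀ`, `W : ι × Fin q`.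
Then there are at most `q` kernel times. [folklore] -/
theorem card_le_index_of_directed (G : ℝ → Matrix ι ι ℝ) (rel : ℝ → ℝ → Prop) (S : Set ℝ)
    (hG : ∀ s ∈ S, (G s).IsSymm)
    (hprop : ∀ s ∈ S, ∀ t ∈ S, rel s t → ∀ x : ι → ℝ, x ≠ 0 → 0 ≤ x ⬝ᵥ (G s *ᵥ x) → 0 < x ⬝ᵥ (G t *ᵥ x))
    {k : ℕ} (τ : Fin k → ℝ) (hS : ∀ j, τ j ∈ S) (hchain : ∀ i j : Fin k, i < j → rel (τ i) (τ j))
    (hdet : ∀ j, (G (τ j)).det = 0) (a : ℝ) (haS : a ∈ S) (ha : ∀ j, rel (τ j) a)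
    (q : ℕ) (W : Matrix ι (Fin q) ℝ) (hW : (W * Wᵀ - G a).PosSemidef) : k ≤ q := by
  have hdata : ∀ j, ∃ v : ι → ℝ, v ≠ 0 ∧ G (τ j) *ᵥ v = 0 := fun j => Matrix.exists_mulVec_eq_zero_iff.2 (hdet j)
  choose v hv0 hker using hdata
  have hli := MomentLaw.linearIndependent_of_directed G rel S hG hprop τ v hS hchain hv0 hker
  by_contra hlt
  push Not at hlt
  -- a nonzero combination in `ker Wᵀ`
  let L : (Fin k → ℝ) →ₗ[ℝ] (Fin q → ℝ) := (Matrix.mulVecLin Wᵀ).comp (Fintype.linearCombination ℝ v)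
  have hker_ne : LinearMap.ker L ≠ ⊥ := by
    apply LinearMap.ker_ne_bot_of_finrank_lt
    simpa [Module.finrank_fin_fun] using hlt
  obtain ⟨c, hcL, hc0⟩ := (Submodule.ne_bot_iff _).1 hker_ne
  set x : ι → ℝ := ∑ i, c i • v i with hx
  have hWx : Wᵀ *ᵥ x = 0 := by
    have := LinearMap.mem_ker.1 hcL
    simp only [L, LinearMap.coe_comp, Function.comp_apply, Fintype.linearCombination_apply,
      Matrix.mulVecLin_apply] at this
    rw [hx]
    exact this
  -- positive at the anchor by the chain, non-positive by the index hypothesis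
  have hpos : 0 < x ⬝ᵥ (G a *ᵥ x) :=
    MomentLaw.quadForm_sum_pos G rel S hG hprop k τ v hS hchain hker hli c hc0 a haS ha
  have hnonpos : x ⬝ᵥ (G a *ᵥ x) ≤ 0 := by
    have h := hW.dotProduct_mulVec_nonneg x
    rw [star_trivial, Matrix.sub_mulVec, dotProduct_sub, ← Matrix.mulVec_mulVec, hWx, Matrix.mulVec_zero,
      dotProduct_zero] at h
    linarith
  linarith

end Engine

/-! ## §2 Pencil windows in index form -/

section Pencil

variable {ι κ : Type} [Fintype ι] [DecidableEq ι] [Fintype κ]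

/-- **Index window law, downward.**  `F = ∑ₖ x^{dₖ} Sₖ` symmetric; `p` a decidable set of scales all `> a`; on `p ∪ {a}`
positivity of every Rayleigh form propagates DOWNWARDS (`0 ≤ vᵀF(t)v ⇒ 0 < vᵀF(s)v` for `s < t`); `F(a) ⪯ W Wᵀ` with
`W : ι × Fin q`.  Then `det F` has at most `q` zeros in `p`. [folklore] -/
theorem card_roots_filter_le_index_down (d : κ → ℕ) (S : κ → Matrix ι ι ℝ) (hS : ∀ k, (S k).IsSymm)
    (p : ℝ → Prop) [DecidablePred p] (a : ℝ) (ha : ∀ x, p x → a < x)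
    (hprop : ∀ v : ι → ℝ, v ≠ 0 → ∀ s t : ℝ, (p s ∨ s = a) → p t → s < t →
      0 ≤ v ⬝ᵥ ((∑ k, t ^ d k • S k) *ᵥ v) → 0 < v ⬝ᵥ ((∑ k, s ^ d k • S k) *ᵥ v))
    (q : ℕ) (W : Matrix ι (Fin q) ℝ) (hW : (W * Wᵀ - ∑ k, a ^ d k • S k).PosSemidef) :
    ((Matrix.det (∑ k, ((X : ℝ[X]) ^ d k) • (S k).map C)).roots.toFinset.filter p).card ≤ q := by
  set R := (Matrix.det (∑ k, ((X : ℝ[X]) ^ d k) • (S k).map C)).roots.toFinset.filter p with hR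
  let τ : Fin R.card ↪o ℝ := R.orderEmbOfFin rfl
  have hτmem : ∀ j, τ j ∈ R := fun j => R.orderEmbOfFin_mem rfl j
  have hτp : ∀ j, p (τ j) := fun j => (Finset.mem_filter.1 (hτmem j)).2
  have hτdet : ∀ j, (∑ k, τ j ^ d k • S k).det = 0 := fun j =>
    det_eval_eq_zero_of_mem d S (Finset.mem_filter.1 (hτmem j)).1
  refine card_le_index_of_directed (fun x => ∑ k, x ^ d k • S k) (fun s t => t < s) {x | p x ∨ x = a}
    (fun s _ => isSymm_eval d S hS s) ?_ (fun j => τ (Fin.rev j)) (fun j => Or.inl (hτp _))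
    (fun i j hij => τ.strictMono (Fin.rev_lt_rev.2 hij)) (fun j => hτdet _) a (Or.inr rfl)
    (fun j => ha _ (hτp _)) q W hW
  intro s hs t ht hts x hx hsx
  -- the later point `s` cannot be the anchor `a` (everything else lies above `a`)
  have hps : p s := by
    rcases hs with hs | hs
    · exact hs
    · exfalso
      rcases ht with ht | ht
      · exact absurd (ha t ht) (by rw [hs] at hts; exact not_lt.2 hts.le)
      · rw [hs, ht] at hts; exact lt_irrefl _ hts
  exact hprop x hx t s ht hps hts hsx

/-- **Index window law, upward.**  As above with positivity propagating UPWARDS towards an anchor `b` above the window: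
`0 ≤ vᵀF(s)v ⇒ 0 < vᵀF(t)v` for `s < t` in `p ∪ {b}`, and `F(b) ⪯ W Wᵀ` ⇒ at most `q` zeros in `p`. [folklore] -/
theorem card_roots_filter_le_index_up (d : κ → ℕ) (S : κ → Matrix ι ι ℝ) (hS : ∀ k, (S k).IsSymm)
    (p : ℝ → Prop) [DecidablePred p] (b : ℝ) (hb : ∀ x, p x → x < b)
    (hprop : ∀ v : ι → ℝ, v ≠ 0 → ∀ s t : ℝ, p s → (p t ∨ t = b) → s < t →
      0 ≤ v ⬝ᵥ ((∑ k, s ^ d k • S k) *ᵥ v) → 0 < v ⬝ᵥ ((∑ k, t ^ d k • S k) *ᵥ v))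
    (q : ℕ) (W : Matrix ι (Fin q) ℝ) (hW : (W * Wᵀ - ∑ k, b ^ d k • S k).PosSemidef) :
    ((Matrix.det (∑ k, ((X : ℝ[X]) ^ d k) • (S k).map C)).roots.toFinset.filter p).card ≤ q := by
  set R := (Matrix.det (∑ k, ((X : ℝ[X]) ^ d k) • (S k).map C)).roots.toFinset.filter p with hR
  let τ : Fin R.card ↪o ℝ := R.orderEmbOfFin rfl
  have hτmem : ∀ j, τ j ∈ R := fun j => R.orderEmbOfFin_mem rfl j
  have hτp : ∀ j, p (τ j) := fun j => (Finset.mem_filter.1 (hτmem j)).2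
  have hτdet : ∀ j, (∑ k, τ j ^ d k • S k).det = 0 := fun j =>
    det_eval_eq_zero_of_mem d S (Finset.mem_filter.1 (hτmem j)).1
  refine card_le_index_of_directed (fun x => ∑ k, x ^ d k • S k) (fun s t => s < t) {x | p x ∨ x = b}
    (fun s _ => isSymm_eval d S hS s) ?_ τ (fun j => Or.inl (hτp _))
    (fun i j hij => τ.strictMono hij) hτdet b (Or.inr rfl) (fun j => hb _ (hτp _)) q W hW
  intro s hs t ht hst x hx hsx
  rcases hs with hs | hs
  · exact hprop x hx s t hs ht hst hsx
  · exfalso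
    rcases ht with ht | ht
    · exact absurd (hb t ht) (by rw [hs] at hst; exact not_lt.2 hst.le)
    · rw [hs, ht] at hst; exact lt_irrefl _ hst

end Pencil

/-! ## §3 The negative-moment law in rank form -/

section Moment

variable (ι κ : Type) [Fintype ι] [DecidableEq ι] [Fintype κ]

omit [DecidableEq ι] in
/-- Domination of the H-form beyond the pivot: if `vᵀJv ≤ 0` and `∑ Pₖ ⪯ W Wᵀ`, then for `s > 0`,
`H(s) = J + ∑ (s^{dₖ}/s^e) Pₖ ⪯ (√C W)(√C W)ᵀ` with `C = ∑ₖ s^{dₖ}/s^e`. [folklore] -/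
theorem hform_le_rank (e : ℕ) (d : κ → ℕ) (J : Matrix ι ι ℝ) (P : κ → Matrix ι ι ℝ) (hJ : J.IsSymm)
    (hP : ∀ k, (P k).PosSemidef) (hJneg : ∀ v : ι → ℝ, v ⬝ᵥ (J *ᵥ v) ≤ 0)
    (q : ℕ) (W : Matrix ι (Fin q) ℝ) (hW : (W * Wᵀ - ∑ k, P k).PosSemidef) {s : ℝ} (hs : 0 < s) :
    ((Real.sqrt (∑ k, s ^ d k / s ^ e) • W) * (Real.sqrt (∑ k, s ^ d k / s ^ e) • W)ᵀ
      - (J + ∑ k, (s ^ d k / s ^ e) • P k)).PosSemidef := by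
  set C : ℝ := ∑ k, s ^ d k / s ^ e with hC
  have hck : ∀ k, 0 ≤ s ^ d k / s ^ e := fun k => div_nonneg (pow_pos hs _).le (pow_pos hs _).le
  have hC0 : 0 ≤ C := Finset.sum_nonneg fun k _ => hck k
  have hCk : ∀ k, s ^ d k / s ^ e ≤ C := fun k =>
    Finset.single_le_sum (f := fun k => s ^ d k / s ^ e) (fun k _ => hck k) (Finset.mem_univ k)
  have hsq : (Real.sqrt C • W) * (Real.sqrt C • W)ᵀ = C • (W * Wᵀ) := by
    rw [Matrix.transpose_smul, Matrix.smul_mul, Matrix.mul_smul, smul_smul, Real.mul_self_sqrt hC0]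
  rw [hsq]
  -- `C·WWᵀ − J − ∑ cₖPₖ = C·(WWᵀ − ∑Pₖ) + ∑ (C − cₖ)Pₖ + (−J)`
  have hdecomp : C • (W * Wᵀ) - (J + ∑ k, (s ^ d k / s ^ e) • P k)
      = C • (W * Wᵀ - ∑ k, P k) + ∑ k, (C - s ^ d k / s ^ e) • P k + (-J) := by
    rw [smul_sub, Finset.smul_sum]
    simp only [sub_smul]
    rw [Finset.sum_sub_distrib]
    abel
  rw [hdecomp]
  refine Matrix.PosSemidef.add (Matrix.PosSemidef.add (hW.smul hC0)
    (Matrix.posSemidef_sum Finset.univ fun k _ => (hP k).smul (sub_nonneg.2 (hCk k)))) ?_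
  refine Matrix.PosSemidef.of_dotProduct_mulVec_nonneg (Matrix.isHermitian_iff_isSymm.2 hJ.neg) fun v => ?_
  rw [star_trivial, Matrix.neg_mulVec, dotProduct_neg]
  exact neg_nonneg.2 (hJneg v)

/-- **THE NEGATIVE-MOMENT LAW, RANK FORM.**  `F(X) = X^e J + ∑ₖ X^{dₖ} Pₖ` with `J` real symmetric, every `Pₖ ⪰ 0` (any
exponents on both sides of `e`), `F(x₀) ≺ 0` at one scale `x₀ > 0`, and `∑ₖ Pₖ ⪯ W Wᵀ` for an `ι × Fin q` matrix `W`
(e.g. `q =` the total rank of the PSD letters).  Then `det F` has at most `2q` distinct positive zeros (`≤ q` on each side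
of `x₀`).  g10's `negMoment_posRoots_le` is the case `q = card ι`. [folklore] -/
theorem negMoment_posRoots_le_rank (e : ℕ) (d : κ → ℕ) (J : Matrix ι ι ℝ) (P : κ → Matrix ι ι ℝ)
    (hJ : J.IsSymm) (hP : ∀ k, (P k).PosSemidef) (x₀ : ℝ) (hx₀ : 0 < x₀)
    (hneg : ∀ v : ι → ℝ, v ≠ 0 → v ⬝ᵥ ((x₀ ^ e • J + ∑ k, x₀ ^ d k • P k) *ᵥ v) < 0)
    (q : ℕ) (W : Matrix ι (Fin q) ℝ) (hW : (W * Wᵀ - ∑ k, P k).PosSemidef) :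
    ((Matrix.det (((Polynomial.X : Polynomial ℝ) ^ e) • J.map Polynomial.C
        + ∑ k, ((Polynomial.X : Polynomial ℝ) ^ d k) • (P k).map Polynomial.C)).roots.toFinset.filter
          (fun t => 0 < t)).card ≤ 2 * q := by
  set pol := Matrix.det (((Polynomial.X : Polynomial ℝ) ^ e) • J.map Polynomial.C
        + ∑ k, ((Polynomial.X : Polynomial ℝ) ^ d k) • (P k).map Polynomial.C) with hpol
  by_cases hdet : pol = 0
  · simp [hdet]
  have hneg' := MomentLaw.hform_neg_of_neg e d J P hx₀ hneg
  have hJneg : ∀ v : ι → ℝ, v ⬝ᵥ (J *ᵥ v) ≤ 0 := by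
    intro v
    by_cases hv : v = 0
    · rw [hv, zero_dotProduct]
    · exact (negMoment_pivot_neg ι κ e d J P hP hx₀ hneg v hv).le
  let G : ℝ → Matrix ι ι ℝ := fun x => J + ∑ k, (x ^ d k / x ^ e) • P k
  have hGs : ∀ x : ℝ, (G x).IsSymm := fun x => MomentLaw.isSymm_hform e d hJ hP x
  have hGdet : ∀ t : ℝ, 0 < t → t ∈ pol.roots.toFinset → (G t).det = 0 := by
    intro t ht hmem
    rw [Multiset.mem_toFinset] at hmem
    exact (MomentLaw.det_hform_eq_zero_iff e d J P ht.ne').2 ((Polynomial.mem_roots hdet).1 hmem)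
  -- below `x₀`: anchor at half the smallest zero, chain directed away from `x₀`
  have hbelow : (pol.roots.toFinset.filter (fun t => 0 < t ∧ t < x₀)).card ≤ q := by
    set R := pol.roots.toFinset.filter (fun t => 0 < t ∧ t < x₀) with hR
    rcases Nat.eq_zero_or_pos R.card with h0 | hpos
    · rw [h0]; exact Nat.zero_le _
    let σ : Fin R.card ↪o ℝ := R.orderEmbOfFin rfl
    have hσmem : ∀ j, σ j ∈ R := fun j => R.orderEmbOfFin_mem rfl j
    have hσin : ∀ j, 0 < σ j ∧ σ j < x₀ := fun j => (Finset.mem_filter.1 (hσmem j)).2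
    set s₀ : ℝ := σ ⟨0, hpos⟩ / 2 with hs₀
    have hs₀pos : 0 < s₀ := by rw [hs₀]; linarith [(hσin ⟨0, hpos⟩).1]
    have hs₀lt : ∀ j, s₀ < σ j := fun j => by
      have h1 : σ ⟨0, hpos⟩ ≤ σ j := σ.monotone (Fin.mk_le_mk.2 (Nat.zero_le _))
      have h2 : s₀ < σ ⟨0, hpos⟩ := by rw [hs₀]; linarith [(hσin ⟨0, hpos⟩).1]
      linarith
    have hs₀x : s₀ < x₀ := (hs₀lt ⟨0, hpos⟩).trans (hσin ⟨0, hpos⟩).2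
    refine card_le_index_of_directed G (fun s t => t < s) (Set.Ioo 0 x₀) (fun s _ => hGs s) ?_
      (fun j => σ (Fin.rev j)) (fun j => hσin _) (fun i j hij => σ.strictMono (Fin.rev_lt_rev.2 hij))
      (fun j => hGdet _ (hσin _).1 (Finset.mem_filter.1 (hσmem _)).1) s₀ ⟨hs₀pos, hs₀x⟩ (fun j => hs₀lt _) q
      (Real.sqrt (∑ k, s₀ ^ d k / s₀ ^ e) • W) (hform_le_rank ι κ e d J P hJ hP hJneg q W hW hs₀pos)
    intro s hs t ht hts x hx hsx
    exact MomentLaw.propagate_below e d J hP hneg' ht.1 hts hs.2 x hx hsx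
  -- above `x₀`: anchor beyond the largest zero, chain directed away from `x₀`
  have habove : (pol.roots.toFinset.filter (fun t => x₀ < t)).card ≤ q := by
    set R := pol.roots.toFinset.filter (fun t => x₀ < t) with hR
    rcases Nat.eq_zero_or_pos R.card with h0 | hpos
    · rw [h0]; exact Nat.zero_le _
    let σ : Fin R.card ↪o ℝ := R.orderEmbOfFin rfl
    have hσmem : ∀ j, σ j ∈ R := fun j => R.orderEmbOfFin_mem rfl j
    have hσgt : ∀ j, x₀ < σ j := fun j => (Finset.mem_filter.1 (hσmem j)).2
    set s₁ : ℝ := σ ⟨R.card - 1, by omega⟩ + 1 with hs₁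
    have hs₁gt : ∀ j, σ j < s₁ := fun j => by
      have h1 : σ j ≤ σ ⟨R.card - 1, by omega⟩ := σ.monotone (Fin.mk_le_mk.2 (by have := j.isLt; omega))
      rw [hs₁]; linarith
    have hs₁x : x₀ < s₁ := (hσgt ⟨R.card - 1, by omega⟩).trans (hs₁gt _)
    have hs₁pos : 0 < s₁ := hx₀.trans hs₁x
    refine card_le_index_of_directed G (fun s t => s < t) (Set.Ioi x₀) (fun s _ => hGs s) ?_
      σ (fun j => hσgt _) (fun i j hij => σ.strictMono hij)
      (fun j => hGdet _ (hx₀.trans (hσgt _)) (Finset.mem_filter.1 (hσmem _)).1) s₁ hs₁x (fun j => hs₁gt _) q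
      (Real.sqrt (∑ k, s₁ ^ d k / s₁ ^ e) • W) (hform_le_rank ι κ e d J P hJ hP hJneg q W hW hs₁pos)
    intro s hs t _ hst x hx hsx
    exact MomentLaw.propagate_above e d J hP hx₀ hneg' hs hst x hx hsx
  -- assembly (no zero at `x₀`)
  have hsplit : pol.roots.toFinset.filter (fun t => 0 < t)
      ⊆ pol.roots.toFinset.filter (fun t => 0 < t ∧ t < x₀) ∪ pol.roots.toFinset.filter (fun t => x₀ < t) := by
    intro t ht
    rw [Finset.mem_filter] at ht
    rw [Finset.mem_union, Finset.mem_filter, Finset.mem_filter]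
    rcases lt_trichotomy t x₀ with h | h | h
    · exact Or.inl ⟨ht.1, ht.2, h⟩
    · exfalso
      subst h
      have hmem := ht.1
      rw [Multiset.mem_toFinset] at hmem
      exact negMoment_not_isRoot ι κ e d J P ht.2 hneg ((Polynomial.mem_roots hdet).1 hmem)
    · exact Or.inr ⟨ht.1, h⟩
  calc (pol.roots.toFinset.filter (fun t => 0 < t)).card
      ≤ (pol.roots.toFinset.filter (fun t => 0 < t ∧ t < x₀) ∪ pol.roots.toFinset.filter (fun t => x₀ < t)).card :=
        Finset.card_le_card hsplit
    _ ≤ (pol.roots.toFinset.filter (fun t => 0 < t ∧ t < x₀)).card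
          + (pol.roots.toFinset.filter (fun t => x₀ < t)).card := Finset.card_union_le _ _
    _ ≤ q + q := Nat.add_le_add hbelow habove
    _ = 2 * q := by ring

end Moment

end DefiniteMoments

end Summit.ValiantsHypothesis.ValiantsHypothesis.Theorems.LacunarySymmetroidMatrixDescartes
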